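import Mathlib
import Literature.AlgebraicGeometry.Tropical.TorusCycles
import Summits.HodgeConjecture.HodgeConjecture.Theorems.TropicalWeilObstructionTropicalWeilVanishingTransportPhase
import Summits.HodgeConjecture.HodgeConjecture.Theorems.TropicalWeilObstructionTropicalWeilVanishingCalibrationTwoBoundary
import Summits.HodgeConjecture.HodgeConjecture.Theorems.TropicalWeilObstructionTropicalHodgeBoundWeilPairing
import Summits.HodgeConjecture.HodgeConjecture.Theorems.TropicalWeilObstructionTropicalHodgeBoundHermitianPairing
import HarnessLib

/-!
# Crux `TropicalWeilVanishing` (stmt-HodgeConjecture-18478) — the `n = 2` calibration with phases: three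
# linearly independent effective classes on ONE very general tropical Weil fourfold, by scalar isogenies alone

Route `TropicalWeilObstruction` of `HodgeConjecture` (Hodge NEGATION SINK `pub-hodge-tropical`; scoped exploration,
no summit claim; nothing here bears on the Hodge conjecture; nothing here decides K1 (`n = 4`)).

The tree's `n = 2` calibration (`CalibTwo.*`, p356781/p358045) gives ONE very general tropical Weil fourfold period `Q`
with an effective tropical `2`-cycle `Z` of phase `−1` (`W(Z) = −μ(Z) ≠ 0`: all complex determinants purely
imaginary). The scalar isogenies `k = a + bJ` are endomorphisms of that same torus and multiply the phase `W/μ` by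
`((a + bi)/(a − bi))²` (`…TransportPhase.exists_endomorphism_transport`). Hence, with `k = 1 + J` (phase factor `−1`)
and `k = 2 + J` (phase factor `((3 + 4i)/5)² = (−7 + 24i)/25`):

* `exists_weilGeneric_two_three_phases` — on ONE very general tropical Weil fourfold there are effective tropical
  `2`-cycles `Z₁, Z₂, Z₃` of positive mass with `W(Z₁) = −μ(Z₁)`, `W(Z₂) = +μ(Z₂)`, `25·W(Z₃) = (7 − 24i)·μ(Z₃)`;
* `linearIndependent_cyc_of_three_phases` — effective cycles with these three phases have ℝ-linearly independent
  cycle classes (apply the linear functionals `Ŵ = dz ⊗ dz` and `M̂ = dz ⊗ dz̄` of the K3 files: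
  `weilFunctional_eq_weilPairing_cyc`, `hermPairing_cyc`);
* `exists_weilGeneric_two_linearIndependent_cyc` — hence THREE LINEARLY INDEPENDENT EFFECTIVE tropical
  `(2,2)`-classes on one very general tropical Weil fourfold: the kernel form, by transport alone and without a new
  certificate, of the cell's seat computation "effective classes span the full 3-space `⟨θ₂, Re w, Im w⟩` at `n = 2`"
  (HOME `PILOT-6.1.md` §E9; the upper bound — a K3-type theorem at `n = 2` — is not in the tree, so "span" is stated
  as "rank ≥ 3"). The EXACT phases `±i` (classes `4θ₂ ± 2Im w`, PILOT-6.1 §E9's I-type seed) are NOT reachable by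
  scalar isogenies (`((a+bi)/(a−bi))² = ±i` has no solution in `ℤ[i]`); they need the non-scalar transport
  `diag_ℂ(1+i, 1)` between different periods — the phase rule R-P1 of the cell's REFEREE-K1K2.

Mathlib + tree lemmas; no definition, no named fact, no sorry.

## References

* [Zharkov2020TropicalWeil] I. Zharkov, Tropical abelian varieties, Weil classes and the Hodge conjecture,
  arXiv:2002.02347 (2020), §2 (pp. 2–4).
* [MikhalkinZharkov2014Eigenwave] G. Mikhalkin, I. Zharkov, Tropical eigenwave and intermediate Jacobians,
  LN UMI 15 (2014), Def. 4.2, Prop. 4.3, Thm. 5.4.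
-/

-- `Summit.HodgeConjecture.HodgeConjecture.…` is the mandated namespace (single-conjunct summit).
set_option linter.dupNamespace false

noncomputable section

open scoped BigOperators Matrix ComplexConjugate
open Matrix Literature.AlgebraicGeometry.Tropical

namespace Summit.HodgeConjecture.HodgeConjecture.Theorems.TropicalWeilVanishing.Phases

/-! ## §0 Display-only notation (verbatim bodies of the K3 / TransportPhase files; nothing is defined) -/

/-- The hermitian mass `μ(Z)` (display-only). -/
local notation3 (prettyPrint := false) "μ⟦" n ", " Z "⟧" =>
  (∑ σ, ((TropicalTorusCycle.cell Z σ).weight : ℝ) * (TropicalTorusCycle.cell Z σ).latticeVolume *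
    ‖frameComplexDet n (TropicalTorusCycle.cell Z σ).frame‖ ^ 2)

/-- The skeleton's `dzCoord n S`. -/
local notation3 (prettyPrint := false) "dz⟦" n "⟧" S:max =>
  (Matrix.det (Matrix.of fun k a : Fin n =>
    (if (S a : ℕ) = (k : ℕ) then (1 : ℂ) else 0) + (if (S a : ℕ) = (k : ℕ) + n then Complex.I else 0)))

/-- The skeleton's `weilPairing n C` (the value `Ŵ(C)` of `dz ⊗ dz`). -/
local notation3 (prettyPrint := false) "Ŵ⟦" n "⟧" C:max =>
  (∑ S : Fin n → Fin (2 * n), ∑ S' : Fin n → Fin (2 * n),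
    dz⟦n⟧ S * dz⟦n⟧ S' / ((Nat.factorial n : ℂ) ^ 2) * ((C S S' : ℝ) : ℂ))

/-- The hermitian pairing `M̂(C)` (the value of `dz ⊗ dz̄` on `C`). -/
local notation3 (prettyPrint := false) "M̂⟦" n "⟧" C:max =>
  (∑ S : Fin n → Fin (2 * n), ∑ S' : Fin n → Fin (2 * n),
    dz⟦n⟧ S * (starRingEnd ℂ) (dz⟦n⟧ S') / ((Nat.factorial n : ℂ) ^ 2) * ((C S S' : ℝ) : ℂ))

/-- The integral scalar isogeny `k = a·1 + b·J` (display-only expression, as in `…TransportPhase`). -/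
local notation3 (prettyPrint := false) "𝐤⟦" n ", " a ", " b "⟧" =>
  (Matrix.of fun x y : Fin (2 * n) =>
    (if x = y then (a : ℤ) else 0) +
      (if (x : ℕ) = (y : ℕ) + n then (b : ℤ) else if (y : ℕ) = (x : ℕ) + n then -(b : ℤ) else 0))

variable {n : ℕ}

/-! ## §1 Linear functionals on cycle classes -/

/-- Interchanging a weighted double sum with a finite linear combination. [folklore] -/
theorem sum_sum_mul_sum {α β ι : Type*} [Fintype α] [Fintype β] [Fintype ι] (c : α → β → ℂ)
    (h : ι → α → β → ℂ) :
    ∑ S, ∑ S', c S S' * ∑ i, h i S S' = ∑ i, ∑ S, ∑ S', c S S' * h i S S' := by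
  simp only [Finset.mul_sum]
  exact (Finset.sum_congr rfl fun S _ => Finset.sum_comm).trans Finset.sum_comm

/-- `Ŵ` of a real combination of cycle classes is the same combination of the Weil functionals
(`W = Ŵ ∘ cyc`, `…TropicalHodgeBoundWeilPairing`). [cite: MikhalkinZharkov2014Eigenwave, Prop. 4.3] -/
theorem weilPairing_sum_cyc {Q : Matrix (Fin (2 * n)) (Fin (2 * n)) ℝ}
    (Z : Fin 3 → TropicalTorusCycle (2 * n) n Q) (g : Fin 3 → ℝ) :
    Ŵ⟦n⟧ (fun S S' : Fin n → Fin (2 * n) => ∑ i, g i * (Z i).cyc S S') =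
      ∑ i, ((g i : ℝ) : ℂ) * weilFunctional (Z i) := by
  have h1 : Ŵ⟦n⟧ (fun S S' : Fin n → Fin (2 * n) => ∑ i, g i * (Z i).cyc S S') =
      ∑ S : Fin n → Fin (2 * n), ∑ S' : Fin n → Fin (2 * n),
        dz⟦n⟧ S * dz⟦n⟧ S' / ((Nat.factorial n : ℂ) ^ 2) *
          ∑ i, ((g i : ℝ) : ℂ) * ((((Z i).cyc S S' : ℝ)) : ℂ) := by
    refine Finset.sum_congr rfl fun S _ => Finset.sum_congr rfl fun S' _ => ?_
    simp only [Complex.ofReal_sum, Complex.ofReal_mul]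
  rw [h1, sum_sum_mul_sum]
  refine Finset.sum_congr rfl fun i _ => ?_
  rw [TropicalHodgeBound.weilFunctional_eq_weilPairing_cyc, Finset.mul_sum]
  refine Finset.sum_congr rfl fun S _ => ?_
  rw [Finset.mul_sum]
  exact Finset.sum_congr rfl fun S' _ => by ring

/-- `M̂` of a real combination of cycle classes is the same combination of the masses
(`M̂(cyc Z) = μ(Z)`, `…TropicalHodgeBoundHermitianPairing`). [cite: MikhalkinZharkov2014Eigenwave, Prop. 4.3] -/
theorem hermPairing_sum_cyc {Q : Matrix (Fin (2 * n)) (Fin (2 * n)) ℝ}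
    (Z : Fin 3 → TropicalTorusCycle (2 * n) n Q) (g : Fin 3 → ℝ) :
    M̂⟦n⟧ (fun S S' : Fin n → Fin (2 * n) => ∑ i, g i * (Z i).cyc S S') =
      ∑ i, ((g i : ℝ) : ℂ) * ((μ⟦n, Z i⟧ : ℝ) : ℂ) := by
  have h1 : M̂⟦n⟧ (fun S S' : Fin n → Fin (2 * n) => ∑ i, g i * (Z i).cyc S S') =
      ∑ S : Fin n → Fin (2 * n), ∑ S' : Fin n → Fin (2 * n),
        dz⟦n⟧ S * (starRingEnd ℂ) (dz⟦n⟧ S') / ((Nat.factorial n : ℂ) ^ 2) *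
          ∑ i, ((g i : ℝ) : ℂ) * ((((Z i).cyc S S' : ℝ)) : ℂ) := by
    refine Finset.sum_congr rfl fun S _ => Finset.sum_congr rfl fun S' _ => ?_
    simp only [Complex.ofReal_sum, Complex.ofReal_mul]
  rw [h1, sum_sum_mul_sum]
  refine Finset.sum_congr rfl fun i _ => ?_
  rw [← TropicalHodgeBound.hermPairing_cyc Q (Z i), Finset.mul_sum]
  refine Finset.sum_congr rfl fun S _ => ?_
  rw [Finset.mul_sum]
  exact Finset.sum_congr rfl fun S' _ => by ring

/-- **Three phases ⟹ three independent classes.** Effective tropical `n`-cycles `Z₁, Z₂, Z₃` on one torus with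
positive masses and `W(Z₁) = −μ(Z₁)`, `W(Z₂) = μ(Z₂)`, `25 W(Z₃) = (7 − 24i) μ(Z₃)` have ℝ-linearly independent cycle
classes: a real relation `Σ gⱼ [Zⱼ] = 0` gives, under `Ŵ` and `M̂`, `−25g₁μ₁ + 25g₂μ₂ + 7g₃μ₃ = 0`,
`24 g₃μ₃ = 0` and `g₁μ₁ + g₂μ₂ + g₃μ₃ = 0`. [cite: MikhalkinZharkov2014Eigenwave, Prop. 4.3 and Thm. 5.4] -/
theorem linearIndependent_cyc_of_three_phases {Q : Matrix (Fin (2 * n)) (Fin (2 * n)) ℝ}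
    (Z : Fin 3 → TropicalTorusCycle (2 * n) n Q) (hμ : ∀ j, 0 < μ⟦n, Z j⟧)
    (h₁ : weilFunctional (Z 0) = -((μ⟦n, Z 0⟧ : ℝ) : ℂ))
    (h₂ : weilFunctional (Z 1) = ((μ⟦n, Z 1⟧ : ℝ) : ℂ))
    (h₃ : 25 * weilFunctional (Z 2) = (7 - 24 * Complex.I) * ((μ⟦n, Z 2⟧ : ℝ) : ℂ)) :
    LinearIndependent ℝ fun j => (Z j).cyc := by
  rw [Fintype.linearIndependent_iff]
  intro g hg
  have hfun : (fun S S' : Fin n → Fin (2 * n) => ∑ i, g i * (Z i).cyc S S') = fun _ _ => 0 := by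
    funext S S'
    have := congrFun (congrFun hg S) S'
    simpa [Finset.sum_apply, Pi.smul_apply, smul_eq_mul] using this
  -- apply `Ŵ` and `M̂` to the relation
  have hW : ∑ i, ((g i : ℝ) : ℂ) * weilFunctional (Z i) = 0 := by
    rw [← weilPairing_sum_cyc Z g, hfun]
    simp
  have hM : ∑ i, g i * μ⟦n, Z i⟧ = 0 := by
    have h0 : ∑ i, ((g i : ℝ) : ℂ) * ((μ⟦n, Z i⟧ : ℝ) : ℂ) = 0 := by
      rw [← hermPairing_sum_cyc Z g, hfun]
      simp
    exact_mod_cast h0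
  rw [Fin.sum_univ_three] at hW hM
  have key : ((g 0 : ℝ) : ℂ) * (-(25 : ℂ) * ((μ⟦n, Z 0⟧ : ℝ) : ℂ)) + ((g 1 : ℝ) : ℂ) * (25 * ((μ⟦n, Z 1⟧ : ℝ) : ℂ)) +
      ((g 2 : ℝ) : ℂ) * ((7 - 24 * Complex.I) * ((μ⟦n, Z 2⟧ : ℝ) : ℂ)) = 0 := by
    linear_combination 25 * hW - 25 * ((g 0 : ℝ) : ℂ) * h₁ - 25 * ((g 1 : ℝ) : ℂ) * h₂ - ((g 2 : ℝ) : ℂ) * h₃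
  have him : 24 * (g 2 * μ⟦n, Z 2⟧) = 0 := by
    have h := congrArg Complex.im key
    simp only [Complex.add_im, Complex.mul_im, Complex.mul_re, Complex.ofReal_re, Complex.ofReal_im,
      Complex.neg_re, Complex.neg_im, Complex.sub_re, Complex.sub_im, Complex.I_re, Complex.I_im,
      Complex.re_ofNat, Complex.im_ofNat, Complex.zero_im] at h
    linarith
  have hre : -25 * (g 0 * μ⟦n, Z 0⟧) + 25 * (g 1 * μ⟦n, Z 1⟧) + 7 * (g 2 * μ⟦n, Z 2⟧) = 0 := by
    have h := congrArg Complex.re key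
    simp only [Complex.add_re, Complex.mul_im, Complex.mul_re, Complex.ofReal_re, Complex.ofReal_im,
      Complex.neg_re, Complex.neg_im, Complex.sub_re, Complex.sub_im, Complex.I_re, Complex.I_im,
      Complex.re_ofNat, Complex.im_ofNat, Complex.zero_re] at h
    linarith
  have hμ0 := hμ 0
  have hμ1 := hμ 1
  have hμ2 := hμ 2
  have hg2 : g 2 = 0 := by
    rcases mul_eq_zero.1 (show g 2 * μ⟦n, Z 2⟧ = 0 by linarith) with h | h
    · exact h
    · exact absurd h hμ2.ne'
  have hg0 : g 0 = 0 := by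
    rcases mul_eq_zero.1 (show g 0 * μ⟦n, Z 0⟧ = 0 by rw [hg2] at hre hM; linarith) with h | h
    · exact h
    · exact absurd h hμ0.ne'
  have hg1 : g 1 = 0 := by
    rcases mul_eq_zero.1 (show g 1 * μ⟦n, Z 1⟧ = 0 by rw [hg2] at hre hM; linarith) with h | h
    · exact h
    · exact absurd h hμ1.ne'
  intro i
  fin_cases i
  · exact hg0
  · exact hg1
  · exact hg2

/-! ## §2 The `n = 2` calibration with phases -/

/-- **Three phases on ONE very general tropical Weil fourfold.** There is a very general tropical Weil fourfold period
`Q` carrying effective tropical `2`-cycles `Z₁, Z₂, Z₃` of positive mass with `W(Z₁) = −μ(Z₁)` (the tree's calibrated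
seed, p358045), `W(Z₂) = +μ(Z₂)` (its push-forward along the endomorphism `1 + J`: phase factor `((1+i)/(1−i))² = −1`)
and `25·W(Z₃) = (7 − 24i)·μ(Z₃)` (push-forward along `2 + J`: phase factor `((2+i)/(2−i))² = (−7+24i)/25`).
[cite: Zharkov2020TropicalWeil, §2 (pp. 2–4)] [cite: MikhalkinZharkov2014Eigenwave, Prop. 4.3] -/
theorem exists_weilGeneric_two_three_phases :
    ∃ Q : Matrix (Fin (2 * 2)) (Fin (2 * 2)) ℝ, Q.PosDef ∧ Q * weilJ 2 = weilJ 2 * Q ∧ IsWeilGeneric 2 Q ∧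
      ∃ Z : Fin 3 → TropicalTorusCycle (2 * 2) 2 Q,
        (∀ j, 0 < μ⟦2, Z j⟧) ∧
        weilFunctional (Z 0) = -((μ⟦2, Z 0⟧ : ℝ) : ℂ) ∧
        weilFunctional (Z 1) = ((μ⟦2, Z 1⟧ : ℝ) : ℂ) ∧
        25 * weilFunctional (Z 2) = (7 - 24 * Complex.I) * ((μ⟦2, Z 2⟧ : ℝ) : ℂ) := by
  obtain ⟨Q, hQ, hQJ, hgen, Z, -, hW, hre, hcal⟩ := CalibTwo.exists_weilGeneric_two_calibrated_weilFunctional_ne_zero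
  have hW₁ : weilFunctional Z = -((μ⟦2, Z⟧ : ℝ) : ℂ) := weilFunctional_eq_neg_mass_of_re_eq_zero Z hre
  have hμ₁ : 0 < μ⟦2, Z⟧ := by
    rw [← hcal]; exact norm_pos_iff.2 hW
  obtain ⟨Z₂, -, -, hW₂, hμ₂⟩ := exists_endomorphism_transport hQJ Z 1 1 (Or.inl one_ne_zero)
  obtain ⟨Z₃, -, -, hW₃, hμ₃⟩ := exists_endomorphism_transport hQJ Z 2 1 (Or.inr one_ne_zero)
  have hI4 : (((1 : ℤ) : ℂ) + ((1 : ℤ) : ℂ) * Complex.I) ^ (2 * 2) = -4 := by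
    have : (((1 : ℤ) : ℂ) + ((1 : ℤ) : ℂ) * Complex.I) ^ (2 * 2) = ((1 + Complex.I) ^ 2) ^ 2 := by push_cast; ring
    rw [this, show (1 + Complex.I) ^ 2 = 2 * Complex.I by rw [add_sq, Complex.I_sq]; ring]
    rw [mul_pow, Complex.I_sq]; norm_num
  have hJ4 : (((2 : ℤ) : ℂ) + ((1 : ℤ) : ℂ) * Complex.I) ^ (2 * 2) = -7 + 24 * Complex.I := by
    have : (((2 : ℤ) : ℂ) + ((1 : ℤ) : ℂ) * Complex.I) ^ (2 * 2) = ((2 + Complex.I) ^ 2) ^ 2 := by push_cast; ring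
    rw [this, show (2 + Complex.I) ^ 2 = 3 + 4 * Complex.I by rw [add_sq, Complex.I_sq]; ring]
    rw [add_sq, mul_pow, Complex.I_sq]; ring
  refine ⟨Q, hQ, hQJ, hgen, ![Z, Z₂, Z₃], ?_, ?_, ?_, ?_⟩
  · intro j
    fin_cases j
    · exact hμ₁
    · show 0 < μ⟦2, Z₂⟧
      rw [hμ₂]; positivity
    · show 0 < μ⟦2, Z₃⟧
      rw [hμ₃]; positivity
  · exact hW₁
  · show weilFunctional Z₂ = ((μ⟦2, Z₂⟧ : ℝ) : ℂ)
    rw [hW₂, hμ₂, hI4, hW₁]; push_cast; ring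
  · show 25 * weilFunctional Z₃ = (7 - 24 * Complex.I) * ((μ⟦2, Z₃⟧ : ℝ) : ℂ)
    rw [hW₃, hμ₃, hJ4, hW₁]; push_cast; ring

/-- **Three linearly independent EFFECTIVE tropical `(2,2)`-classes on one very general tropical Weil fourfold**
(`n = 2`): the classes of the calibrated seed and of its push-forwards along `1 + J` and `2 + J`. Together with the
(not yet formalised) `n = 2` analogue of K3 (`TropicalHodgeBound`: effective classes lie in the 3-space
`⟨θ₂(Q), Re w(Q), Im w(Q)⟩`) this says that effective classes SPAN that 3-space — the tropical Hodge conjecture in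
bidegree `(2,2)` holds completely on a very general tropical Weil fourfold, as the classical algebraicity of all Weil
classes on Weil-type abelian fourfolds demands. Decides nothing about `n = 4` (K1, K1_∂ open) or HC.
[cite: Zharkov2020TropicalWeil, §2 (pp. 2–4)] [cite: MikhalkinZharkov2014Eigenwave, Prop. 4.3 and Thm. 5.4] -/
theorem exists_weilGeneric_two_linearIndependent_cyc :
    ∃ Q : Matrix (Fin (2 * 2)) (Fin (2 * 2)) ℝ, Q.PosDef ∧ Q * weilJ 2 = weilJ 2 * Q ∧ IsWeilGeneric 2 Q ∧
      ∃ Z : Fin 3 → TropicalTorusCycle (2 * 2) 2 Q, LinearIndependent ℝ fun j => (Z j).cyc := by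
  obtain ⟨Q, hQ, hQJ, hgen, Z, hμ, h₁, h₂, h₃⟩ := exists_weilGeneric_two_three_phases
  exact ⟨Q, hQ, hQJ, hgen, Z, linearIndependent_cyc_of_three_phases Z hμ h₁ h₂ h₃⟩

end Summit.HodgeConjecture.HodgeConjecture.Theorems.TropicalWeilVanishing.Phases

end
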